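import Summits.CriticalPhenomena.PercolationContinuityZ3.Theorems.PercNearOneGluingNoHeavyQuantIndepBlobGapRow
import HarnessLib

/-!
# QUANT lane R8, FAR on block-combs with TWO HEIGHTS: the exchange inequality when the deeper height has gates `≥ 1/2` —
# 'room at the bottom' (no other hypothesis) and 'room at the top' (upper gates `≥ 1/2` too)

builds on p205010 (kernel theorem, internal audit signed; external expert review pending)

Support file (`--supports stmt-CriticalPhenomena-4575`), QUANT lane lead (gen 11), rung R8 of `run/shared/lean/prim/quant/LADDER.md`;
paper `run/shared/lean/prim/quant/prim-quant-lead-g11/LEAD-NOTES-G11.md` N22 (3′)(3″).  Theorems only (the Finset-weight vocabulary of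
`…QuantIndepBlobFar.lean` / `…QuantIndepBlobGapRow.lean`); no definitions, no sorries, standard axioms.

**Setting.**  A block-comb with two heights: the upper height carries independent blobs `i : ι` (sizes `a i ≥ 0`, gates `p i`) at chain weight `w₁`,
the lower height blobs `k : κ` (sizes `b k ≥ 0`, gates `q k ≥ u₀ ≥ 1/2`) at chain weight `w₂ ≤ w₁`, the terminal block (size `c`) at weight `x ≤ u₀·w₂`
(the argmin constraint).  With `X = Σ_{open i} a i`, `Y = Σ_{open k} b k`, `η = t + 1`, `λ = t − c + 1`, the far-relay row at layer `t` is (lead g10 N21 (1), typer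
g14 `Quant.blockComb_exchange_identity`, lead g11 N22 (3)) the EXCHANGE INEQUALITY
`x·P(X + Y < λ) ≤ (w₁ − w₂)·P(X ≥ η) + (w₂ − x)·P(X + Y ≥ η)` — crossings achieved inside the upper height earn `w₁ − x`, the others `w₂ − x`.
* `Quant.IndepBlob.twoHeight_fibre` — ONE FIBRE: for a fixed upper configuration of mass `s ≥ 0` with `(λ − s) + (η − s) ≤ Σ b`, the gap row
  `IndepBlob.gapRow_of_half_le_gate` (p1 g7) for the lower height gives `x·P(Y < λ − s) ≤ (w₂ − x)·P(Y ≥ η − s)`.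
* `Quant.IndepBlob.twoHeight_exchange_of_topRoom` — **ROOM AT THE TOP**: upper gates `≥ p₀ ≥ 1/2` too, `x ≤ p₀·w₁`, and `sstar + eta ≤ Σ a`
  (`2·sstar ≥ lam + eta − Σ b`, `sstar ≤ eta`): fibres of upper mass `≥ sstar` have room at the bottom, the others are paid by the gap row for the
  upper height (credit `w₁ − x` of the crossings inside the upper height).  [N22 (3″).]
* `Quant.IndepBlob.twoHeight_exchange_of_bottomRoom` — **ROOM AT THE BOTTOM**: if `λ ≤ η` and `λ + η ≤ Σ_k b k` then the exchange inequality holds, for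
  ARBITRARY upper gates and sizes and WITHOUT any budget hypothesis (every fibre has room).  [N22 (3′): e.g. FAR at layer `j` for every two-height
  block-comb whose deeper tied height has gate `≥ 1/2` and mass `≥ 2j + 2 − c`.]
Exact checks: `prim-quant-lead-g11/explore/twoL.py` (31 156 random instances in the regime, every fibre certified).  The complementary regime 'room at the
top' (upper gates `≥ 1/2`, `⌈(λ+η−Σb)/2⌉ + η ≤ Σ a`) and the thin residual (both heights short) are N22 (3″).  [this work]; the gap row is p1 g7's.
-/

namespace Summit.CriticalPhenomena.PercolationContinuityZ3.Theorems

namespace Quant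

namespace IndepBlob

open Finset

variable {ι : Type*} [Fintype ι] [DecidableEq ι] {κ : Type*} [Fintype κ] [DecidableEq κ]

/-- **One fibre of the two-height exchange inequality.**  Lower blobs `k : κ` with sizes `b k ≥ 0` and gates `u₀ ≤ q k ≤ 1`, `1/2 ≤ u₀`; thresholds
with `(lam − s) ≤ (eta − s)` and `(lam − s) + (eta − s) ≤ Σ b`; `0 ≤ x ≤ u₀ · w₂`.  Then
`x · Σ_{V : s + b(V) < lam} w(V) ≤ (w₂ − x) · Σ_{V : eta ≤ s + b(V)} w(V)`. [this work] -/
theorem twoHeight_fibre (q b : κ → ℝ) (u₀ : ℝ) (hhalf : 1 / 2 ≤ u₀) (hu₀1 : u₀ ≤ 1) (hq : ∀ k, u₀ ≤ q k)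
    (hq1 : ∀ k, q k ≤ 1) (hb : ∀ k, 0 ≤ b k) (w₂ x : ℝ) (hx0 : 0 ≤ x) (hx : x ≤ u₀ * w₂)
    (lam eta s : ℝ) (hle : lam ≤ eta) (hroom : (lam - s) + (eta - s) ≤ ∑ k, b k) :
    x * (∑ V ∈ (Finset.univ : Finset (Finset κ)).filter (fun V => s + ∑ k ∈ V, b k < lam),
        (∏ k, if k ∈ V then q k else 1 - q k)) ≤
      (w₂ - x) * (∑ V ∈ (Finset.univ : Finset (Finset κ)).filter (fun V => eta ≤ s + ∑ k ∈ V, b k),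
        (∏ k, if k ∈ V then q k else 1 - q k)) := by
  have hu₀ : 0 < u₀ := by linarith
  have hg := gapRow_of_half_le_gate q b u₀ hhalf hu₀1 hq hq1 hb (lam - s) (eta - s) (by linarith) hroom
  have e1 : (Finset.univ : Finset (Finset κ)).filter (fun V => s + ∑ k ∈ V, b k < lam) =
      (Finset.univ : Finset (Finset κ)).filter (fun V => ∑ k ∈ V, b k < lam - s) := by
    ext V; simp only [Finset.mem_filter, Finset.mem_univ, true_and]; constructor <;> intro h <;> linarith
  have e2 : (Finset.univ : Finset (Finset κ)).filter (fun V => eta ≤ s + ∑ k ∈ V, b k) =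
      (Finset.univ : Finset (Finset κ)).filter (fun V => eta - s ≤ ∑ k ∈ V, b k) := by
    ext V; simp only [Finset.mem_filter, Finset.mem_univ, true_and]; constructor <;> intro h <;> linarith
  rw [e1, e2]
  set L := ∑ V ∈ (Finset.univ : Finset (Finset κ)).filter (fun V => ∑ k ∈ V, b k < lam - s),
        (∏ k, if k ∈ V then q k else 1 - q k)
  set H := ∑ V ∈ (Finset.univ : Finset (Finset κ)).filter (fun V => eta - s ≤ ∑ k ∈ V, b k),
        (∏ k, if k ∈ V then q k else 1 - q k)
  have hw0 : ∀ V : Finset κ, 0 ≤ (∏ k, if k ∈ V then q k else 1 - q k) :=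
    bernoulliWeight_nonneg (fun k => (le_of_lt hu₀).trans (hq k)) hq1
  have hH : 0 ≤ H := Finset.sum_nonneg fun V _ => hw0 V
  have hL : 0 ≤ L := Finset.sum_nonneg fun V _ => hw0 V
  -- `u₀ · (x L) ≤ x (1 − u₀) H ≤ u₀ (w₂ − x) H`
  have h1 : u₀ * (x * L) ≤ x * ((1 - u₀) * H) := by nlinarith [mul_le_mul_of_nonneg_left hg hx0]
  have h2 : x * (1 - u₀) ≤ u₀ * (w₂ - x) := by nlinarith
  have h3 : x * ((1 - u₀) * H) ≤ u₀ * ((w₂ - x) * H) := by nlinarith [mul_le_mul_of_nonneg_right h2 hH]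
  exact le_of_mul_le_mul_left (h1.trans h3) hu₀

/-- **Two-height exchange inequality, ROOM AT THE BOTTOM.**  Upper blobs `i : ι` (sizes `a i ≥ 0`, gates `0 ≤ p i ≤ 1`, ARBITRARY), lower blobs
`k : κ` (sizes `b k ≥ 0`, gates `u₀ ≤ q k ≤ 1` with `1/2 ≤ u₀`), chain weights `w₂ ≤ w₁`, least marginal `0 ≤ x ≤ u₀ · w₂`, thresholds `lam ≤ eta` with
`lam + eta ≤ Σ_k b k`.  Then
`x · Σ_U w(U) Σ_{V : a(U)+b(V) < lam} w(V) ≤ (w₁ − w₂) · Σ_{U : eta ≤ a(U)} w(U) + (w₂ − x) · Σ_U w(U) Σ_{V : eta ≤ a(U)+b(V)} w(V)`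
— the far-relay row at layer `t` (`eta = t+1`, `lam = t−c+1`) for the two-height block-comb, with no hypothesis on the upper height and no budget.
[this work] -/
theorem twoHeight_exchange_of_bottomRoom (p a : ι → ℝ) (q b : κ → ℝ) (u₀ : ℝ) (hhalf : 1 / 2 ≤ u₀) (hu₀1 : u₀ ≤ 1)
    (hq : ∀ k, u₀ ≤ q k) (hq1 : ∀ k, q k ≤ 1) (hp0 : ∀ i, 0 ≤ p i) (hp1 : ∀ i, p i ≤ 1)
    (ha : ∀ i, 0 ≤ a i) (hb : ∀ k, 0 ≤ b k) (w₁ w₂ x : ℝ) (hw : w₂ ≤ w₁) (hx0 : 0 ≤ x) (hx : x ≤ u₀ * w₂)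
    (lam eta : ℝ) (hle : lam ≤ eta) (hroom : lam + eta ≤ ∑ k, b k) :
    x * (∑ U : Finset ι, (∏ i, if i ∈ U then p i else 1 - p i) *
        ∑ V ∈ (Finset.univ : Finset (Finset κ)).filter (fun V => ∑ i ∈ U, a i + ∑ k ∈ V, b k < lam),
          (∏ k, if k ∈ V then q k else 1 - q k)) ≤
      (w₁ - w₂) * (∑ U ∈ (Finset.univ : Finset (Finset ι)).filter (fun U => eta ≤ ∑ i ∈ U, a i),
          (∏ i, if i ∈ U then p i else 1 - p i)) +
        (w₂ - x) * (∑ U : Finset ι, (∏ i, if i ∈ U then p i else 1 - p i) *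
          ∑ V ∈ (Finset.univ : Finset (Finset κ)).filter (fun V => eta ≤ ∑ i ∈ U, a i + ∑ k ∈ V, b k),
            (∏ k, if k ∈ V then q k else 1 - q k)) := by
  have hwX0 : ∀ U : Finset ι, 0 ≤ (∏ i, if i ∈ U then p i else 1 - p i) := bernoulliWeight_nonneg hp0 hp1
  have hu₀ : 0 < u₀ := by linarith
  have hwY0 : ∀ V : Finset κ, 0 ≤ (∏ k, if k ∈ V then q k else 1 - q k) :=
    bernoulliWeight_nonneg (fun k => (le_of_lt hu₀).trans (hq k)) hq1
  -- fibrewise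
  have hfib : ∀ U : Finset ι,
      x * ((∏ i, if i ∈ U then p i else 1 - p i) *
          ∑ V ∈ (Finset.univ : Finset (Finset κ)).filter (fun V => ∑ i ∈ U, a i + ∑ k ∈ V, b k < lam),
            (∏ k, if k ∈ V then q k else 1 - q k)) ≤
        (w₂ - x) * ((∏ i, if i ∈ U then p i else 1 - p i) *
          ∑ V ∈ (Finset.univ : Finset (Finset κ)).filter (fun V => eta ≤ ∑ i ∈ U, a i + ∑ k ∈ V, b k),
            (∏ k, if k ∈ V then q k else 1 - q k)) := by
    intro U
    have hs0 : 0 ≤ ∑ i ∈ U, a i := Finset.sum_nonneg fun i _ => ha i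
    have hf := twoHeight_fibre q b u₀ hhalf hu₀1 hq hq1 hb w₂ x hx0 hx lam eta (∑ i ∈ U, a i) hle (by linarith)
    have := mul_le_mul_of_nonneg_left hf (hwX0 U)
    calc x * ((∏ i, if i ∈ U then p i else 1 - p i) *
            ∑ V ∈ (Finset.univ : Finset (Finset κ)).filter (fun V => ∑ i ∈ U, a i + ∑ k ∈ V, b k < lam),
              (∏ k, if k ∈ V then q k else 1 - q k))
          = (∏ i, if i ∈ U then p i else 1 - p i) *
            (x * ∑ V ∈ (Finset.univ : Finset (Finset κ)).filter (fun V => ∑ i ∈ U, a i + ∑ k ∈ V, b k < lam),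
              (∏ k, if k ∈ V then q k else 1 - q k)) := by ring
      _ ≤ (∏ i, if i ∈ U then p i else 1 - p i) *
            ((w₂ - x) * ∑ V ∈ (Finset.univ : Finset (Finset κ)).filter (fun V => eta ≤ ∑ i ∈ U, a i + ∑ k ∈ V, b k),
              (∏ k, if k ∈ V then q k else 1 - q k)) := this
      _ = (w₂ - x) * ((∏ i, if i ∈ U then p i else 1 - p i) *
          ∑ V ∈ (Finset.univ : Finset (Finset κ)).filter (fun V => eta ≤ ∑ i ∈ U, a i + ∑ k ∈ V, b k),
            (∏ k, if k ∈ V then q k else 1 - q k)) := by ring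
  have hsum := Finset.sum_le_sum fun U (_ : U ∈ (Finset.univ : Finset (Finset ι))) => hfib U
  rw [← Finset.mul_sum, ← Finset.mul_sum] at hsum
  have hextra : 0 ≤ (w₁ - w₂) * (∑ U ∈ (Finset.univ : Finset (Finset ι)).filter (fun U => eta ≤ ∑ i ∈ U, a i),
      (∏ i, if i ∈ U then p i else 1 - p i)) :=
    mul_nonneg (by linarith) (Finset.sum_nonneg fun U _ => hwX0 U)
  linarith

/-- **Two-height exchange inequality, ROOM AT THE TOP.**  As in `twoHeight_exchange_of_bottomRoom`, but instead of `lam + eta ≤ Σ b` assume that the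
UPPER gates are also `≥ 1/2` (`1/2 ≤ p₀ ≤ p i`, `x ≤ p₀ · w₁`) and that the upper height has room above the bad fibres:
`sstar + eta ≤ Σ_i a i` where `2·sstar ≥ lam + eta − Σ_k b k` and `sstar ≤ eta`.  Fibres of upper mass `≥ sstar` have room at the bottom; the
others cost at most their own weight, which the gap row for the upper height moves onto the crossings inside the upper height (credit `w₁ − x`).
[this work] -/
theorem twoHeight_exchange_of_topRoom (p a : ι → ℝ) (q b : κ → ℝ) (p₀ u₀ : ℝ) (hhalfp : 1 / 2 ≤ p₀) (hp₀1 : p₀ ≤ 1)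
    (hhalf : 1 / 2 ≤ u₀) (hu₀1 : u₀ ≤ 1) (hp : ∀ i, p₀ ≤ p i) (hp1 : ∀ i, p i ≤ 1)
    (hq : ∀ k, u₀ ≤ q k) (hq1 : ∀ k, q k ≤ 1) (ha : ∀ i, 0 ≤ a i) (hb : ∀ k, 0 ≤ b k)
    (w₁ w₂ x : ℝ) (hx0 : 0 ≤ x) (hx : x ≤ u₀ * w₂) (hx1 : x ≤ p₀ * w₁)
    (lam eta sstar : ℝ) (hle : lam ≤ eta) (hsstar : lam + eta - ∑ k, b k ≤ 2 * sstar) (hse : sstar ≤ eta)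
    (htop : sstar + eta ≤ ∑ i, a i) :
    x * (∑ U : Finset ι, (∏ i, if i ∈ U then p i else 1 - p i) *
        ∑ V ∈ (Finset.univ : Finset (Finset κ)).filter (fun V => ∑ i ∈ U, a i + ∑ k ∈ V, b k < lam),
          (∏ k, if k ∈ V then q k else 1 - q k)) ≤
      (w₁ - w₂) * (∑ U ∈ (Finset.univ : Finset (Finset ι)).filter (fun U => eta ≤ ∑ i ∈ U, a i),
          (∏ i, if i ∈ U then p i else 1 - p i)) +
        (w₂ - x) * (∑ U : Finset ι, (∏ i, if i ∈ U then p i else 1 - p i) *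
          ∑ V ∈ (Finset.univ : Finset (Finset κ)).filter (fun V => eta ≤ ∑ i ∈ U, a i + ∑ k ∈ V, b k),
            (∏ k, if k ∈ V then q k else 1 - q k)) := by
  have hp₀ : 0 < p₀ := by linarith
  have hu₀ : 0 < u₀ := by linarith
  have hp0 : ∀ i, 0 ≤ p i := fun i => (le_of_lt hp₀).trans (hp i)
  have hwX0 : ∀ U : Finset ι, 0 ≤ (∏ i, if i ∈ U then p i else 1 - p i) := bernoulliWeight_nonneg hp0 hp1
  have hwY0 : ∀ V : Finset κ, 0 ≤ (∏ k, if k ∈ V then q k else 1 - q k) :=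
    bernoulliWeight_nonneg (fun k => (le_of_lt hu₀).trans (hq k)) hq1
  have hw₂0 : 0 ≤ w₂ := by nlinarith
  have hw₂x : 0 ≤ w₂ - x := by nlinarith
  -- notation-free abbreviations via `set` would be heavy; we prove a per-fibre bound with two correction indicators
  have hfib : ∀ U : Finset ι,
      x * ((∏ i, if i ∈ U then p i else 1 - p i) *
          ∑ V ∈ (Finset.univ : Finset (Finset κ)).filter (fun V => ∑ i ∈ U, a i + ∑ k ∈ V, b k < lam),
            (∏ k, if k ∈ V then q k else 1 - q k)) ≤
        (w₂ - x) * ((∏ i, if i ∈ U then p i else 1 - p i) *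
          ∑ V ∈ (Finset.univ : Finset (Finset κ)).filter (fun V => eta ≤ ∑ i ∈ U, a i + ∑ k ∈ V, b k),
            (∏ k, if k ∈ V then q k else 1 - q k)) -
          (w₂ - x) * ((∏ i, if i ∈ U then p i else 1 - p i) * (if eta ≤ ∑ i ∈ U, a i then 1 else 0)) +
          x * ((∏ i, if i ∈ U then p i else 1 - p i) * (if ∑ i ∈ U, a i < sstar then 1 else 0)) := by
    intro U
    set s := ∑ i ∈ U, a i with hs
    set wU := (∏ i, if i ∈ U then p i else 1 - p i) with hwU
    have hwU0 : 0 ≤ wU := hwX0 U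
    set L := ∑ V ∈ (Finset.univ : Finset (Finset κ)).filter (fun V => s + ∑ k ∈ V, b k < lam),
        (∏ k, if k ∈ V then q k else 1 - q k) with hL
    set H := ∑ V ∈ (Finset.univ : Finset (Finset κ)).filter (fun V => eta ≤ s + ∑ k ∈ V, b k),
        (∏ k, if k ∈ V then q k else 1 - q k) with hH
    have hH0 : 0 ≤ H := Finset.sum_nonneg fun V _ => hwY0 V
    have hL0 : 0 ≤ L := Finset.sum_nonneg fun V _ => hwY0 V
    have hL1 : L ≤ 1 := by
      calc L ≤ ∑ V : Finset κ, (∏ k, if k ∈ V then q k else 1 - q k) :=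
            Finset.sum_le_sum_of_subset_of_nonneg (Finset.subset_univ _) fun V _ _ => hwY0 V
        _ = 1 := sum_bernoulliWeight q
    by_cases hη : eta ≤ s
    · -- no light configuration in this fibre; use no credit
      have hLz : L = 0 := by
        rw [hL]
        refine Finset.sum_eq_zero fun V hV => ?_
        rw [Finset.mem_filter] at hV
        have : 0 ≤ ∑ k ∈ V, b k := Finset.sum_nonneg fun k _ => hb k
        linarith [hV.2]
      have hnb : ¬ (s < sstar) := by intro h'; linarith
      rw [if_pos hη, if_neg hnb, hLz]
      have hH1 : H = 1 := by
        have hfilt : (Finset.univ : Finset (Finset κ)).filter (fun V => eta ≤ s + ∑ k ∈ V, b k) = Finset.univ := by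
          refine Finset.filter_true_of_mem fun V _ => ?_
          have : 0 ≤ ∑ k ∈ V, b k := Finset.sum_nonneg fun k _ => hb k
          linarith
        rw [hH, hfilt]
        exact sum_bernoulliWeight q
      rw [hH1]
      nlinarith
    · rw [if_neg hη]
      by_cases hbad : s < sstar
      · -- a bad fibre costs at most its own weight
        rw [if_pos hbad]
        have h1 : x * (wU * L) ≤ x * (wU * 1) :=
          mul_le_mul_of_nonneg_left (mul_le_mul_of_nonneg_left hL1 hwU0) hx0
        have h2 : 0 ≤ (w₂ - x) * (wU * H) := mul_nonneg hw₂x (mul_nonneg hwU0 hH0)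
        nlinarith
      · -- a good fibre: room at the bottom
        rw [if_neg hbad]
        have hroom : (lam - s) + (eta - s) ≤ ∑ k, b k := by
          have : sstar ≤ s := not_lt.1 hbad
          linarith
        have hf := twoHeight_fibre q b u₀ hhalf hu₀1 hq hq1 hb w₂ x hx0 hx lam eta s hle hroom
        have := mul_le_mul_of_nonneg_left hf hwU0
        nlinarith
  have hsum := Finset.sum_le_sum fun U (_ : U ∈ (Finset.univ : Finset (Finset ι))) => hfib U
  rw [← Finset.mul_sum] at hsum
  rw [Finset.sum_add_distrib, Finset.sum_sub_distrib, ← Finset.mul_sum, ← Finset.mul_sum, ← Finset.mul_sum] at hsum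
  -- the two indicator sums
  have hind1 : ∑ U : Finset ι, (∏ i, if i ∈ U then p i else 1 - p i) * (if eta ≤ ∑ i ∈ U, a i then (1 : ℝ) else 0) =
      ∑ U ∈ (Finset.univ : Finset (Finset ι)).filter (fun U => eta ≤ ∑ i ∈ U, a i), (∏ i, if i ∈ U then p i else 1 - p i) := by
    rw [Finset.sum_filter]
    refine Finset.sum_congr rfl fun U _ => ?_
    split_ifs <;> simp
  have hind2 : ∑ U : Finset ι, (∏ i, if i ∈ U then p i else 1 - p i) * (if ∑ i ∈ U, a i < sstar then (1 : ℝ) else 0) =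
      ∑ U ∈ (Finset.univ : Finset (Finset ι)).filter (fun U => ∑ i ∈ U, a i < sstar), (∏ i, if i ∈ U then p i else 1 - p i) := by
    rw [Finset.sum_filter]
    refine Finset.sum_congr rfl fun U _ => ?_
    split_ifs <;> simp
  rw [hind1, hind2] at hsum
  -- the gap row for the upper height moves the bad fibres onto the crossings inside the upper height
  have hgap := gapRow_of_half_le_gate p a p₀ hhalfp hp₀1 hp hp1 ha sstar eta hse htop
  set Bd := ∑ U ∈ (Finset.univ : Finset (Finset ι)).filter (fun U => ∑ i ∈ U, a i < sstar),
      (∏ i, if i ∈ U then p i else 1 - p i) with hBd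
  set Tp := ∑ U ∈ (Finset.univ : Finset (Finset ι)).filter (fun U => eta ≤ ∑ i ∈ U, a i),
      (∏ i, if i ∈ U then p i else 1 - p i) with hTp
  have hTp0 : 0 ≤ Tp := Finset.sum_nonneg fun U _ => hwX0 U
  have g1 : p₀ * (x * Bd) ≤ x * ((1 - p₀) * Tp) := by nlinarith [mul_le_mul_of_nonneg_left hgap hx0]
  have g2 : x * (1 - p₀) ≤ p₀ * (w₁ - x) := by nlinarith
  have g3 : x * ((1 - p₀) * Tp) ≤ p₀ * ((w₁ - x) * Tp) := by nlinarith [mul_le_mul_of_nonneg_right g2 hTp0]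
  have g4 : x * Bd ≤ (w₁ - x) * Tp := le_of_mul_le_mul_left (g1.trans g3) hp₀
  linarith

end IndepBlob

end Quant

end Summit.CriticalPhenomena.PercolationContinuityZ3.Theorems
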